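import Literature.Probability.Percolation.ZdCrossingTranspose
import HarnessLib

/-!
# Two planar lemmas for rectangle crossings, translated to an arbitrary box

Topic `Literature/Probability/Percolation`; proofs only. Tools for the arm / dual-bridge duality
`KSTPeriodic.ArmDuality` of [KohlerSchindlerTassion2023, §1 'Duality'] (`KSTPeriodicArmDuality.lean`),
which lives in a rectangle `[x₁, x₂] × [y₁, y₂]` at an arbitrary position, whereas the planar
lemmas of the tree are stated for `[0, M] × [0, N]`:

* `exists_dart_sepEdge_mem_edges_box`: the transposed discrete Jordan curve theorem
  `exists_dart_sepEdge_mem_edges_tb` (a bottom–top lattice walk of a box and a right–left walk of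
  faces of its vertical dual cross) translated to the box `[L, R] × [B, T]`;
* `exists_faceWalk_box`: the transposed parity lemma `exists_faceWalk_of_bottom_top` (bottom row
  coloured, top row uncoloured ⟹ a right–left face walk crossing only colour-changing edges)
  translated to `[L, R] × [B, T]`;
* `sepLo_add_right`, `sepHi_add_right`, `sepEdge_add_right`: the edge separating two adjacent
  faces commutes with translations (the transport behind both);
* `exists_walk_row`: straight walks along a row; `sepEdge_eq_of_row`: a step between two faces of
  one row crosses the vertical edge between them.

## References

* [BollobasRiordan2006] B. Bollobás, O. Riordan, *Percolation* (2006), Ch. 3, Lemma 1.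
* [KohlerSchindlerTassion2023] L. Köhler-Schindler, V. Tassion, *Crossing probabilities for
  planar percolation*, Duke Math. J. 172 (2023) 809–838, §1 'Duality'.
-/

namespace Literature.Probability.Percolation

open LatticeModels SimpleGraph

noncomputable section

namespace KSTPeriodic

/-! ### Translating the two planar lemmas to an arbitrary box -/

/-- `sepLo` commutes with translations. [folklore] -/
theorem sepLo_add_right (z z' v : Site 2) : sepLo (z + v) (z' + v) = sepLo z z' + v :=
  (sup_add z z' v).symm

/-- `sepHi` commutes with translations. [folklore] -/
theorem sepHi_add_right (z z' v : Site 2) : sepHi (z + v) (z' + v) = sepHi z z' + v := by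
  have h : ((z + v) 0 = (z' + v) 0) = (z 0 = z' 0) := by simp
  simp only [sepHi, h, ← sup_add]
  exact add_right_comm _ _ _

/-- `sepEdge` commutes with translations. [folklore] -/
theorem sepEdge_add_right (z z' v : Site 2) :
    sepEdge (z + v) (z' + v) = Sym2.map (· + v) (sepEdge z z') := by
  rw [sepEdge, sepEdge, sepLo_add_right, sepHi_add_right, Sym2.map_mk]

/-- **A bottom–top walk of a box and a right–left face walk of its vertical dual cross**
(`exists_dart_sepEdge_mem_edges_tb` translated to the box `[L, R] × [B, T]`): if `P` is a lattice
walk inside the box from its bottom row to its top row and `Q` a walk of faces (lower-left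
corners) inside `[L - 1, R] × [B, T - 1]` from the column `R` to the column `L - 1`, some dart of `Q`
crosses an edge of `P`. [cite: BollobasRiordan2006, Ch. 3, Lemma 1] -/
theorem exists_dart_sepEdge_mem_edges_box {L R B T : ℤ} {a b t s : Site 2}
    (P : (zdGraph 2).Walk a b) (Q : (zdGraph 2).Walk t s)
    (hP : ∀ z ∈ P.support, L ≤ z 0 ∧ z 0 ≤ R ∧ B ≤ z 1 ∧ z 1 ≤ T)
    (hQ : ∀ z ∈ Q.support, L - 1 ≤ z 0 ∧ z 0 ≤ R ∧ B ≤ z 1 ∧ z 1 + 1 ≤ T)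
    (ha : a 1 = B) (hb : b 1 = T) (ht : t 0 = R) (hs : s 0 = L - 1) :
    ∃ dq ∈ Q.darts, sepEdge dq.fst dq.snd ∈ P.edges := by
  classical
  have haR := hP a P.start_mem_support
  obtain ⟨M, hM⟩ : ∃ M : ℕ, (M : ℤ) = R - L := ⟨(R - L).toNat, Int.toNat_of_nonneg (by omega)⟩
  obtain ⟨N, hN⟩ : ∃ N : ℕ, (N : ℤ) = T - B := ⟨(T - B).toNat, Int.toNat_of_nonneg (by omega)⟩
  set v : Site 2 := ![-L, -B] with hv
  have hv0 : v 0 = -L := rfl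
  have hv1 : v 1 = -B := rfl
  set φ := (zdShiftIso v).toEmbedding.toHom with hφ
  have hφapply : ∀ x : Site 2, φ x = x + v := fun x => rfl
  obtain ⟨dq', hdq', hsep⟩ := exists_dart_sepEdge_mem_edges_tb (M := M) (N := N) (P.map φ) (Q.map φ)
    (fun z hz => by
      rw [Walk.support_map, List.mem_map] at hz
      obtain ⟨w, hw, rfl⟩ := hz
      have := hP w hw
      simp only [hφapply, Pi.add_apply, hv0, hv1]
      omega)
    (fun z hz => by
      rw [Walk.support_map, List.mem_map] at hz
      obtain ⟨w, hw, rfl⟩ := hz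
      have := hQ w hw
      simp only [hφapply, Pi.add_apply, hv0, hv1]
      omega)
    (by show (a + v) 1 = 0; rw [Pi.add_apply, hv1, ha]; ring)
    (by show (b + v) 1 = (N : ℤ); rw [Pi.add_apply, hv1, hb, hN]; ring)
    (by show (t + v) 0 = (M : ℤ); rw [Pi.add_apply, hv0, ht, hM]; ring)
    (by show (s + v) 0 = -1; rw [Pi.add_apply, hv0, hs]; ring)
  rw [Walk.darts_map, List.mem_map] at hdq'
  obtain ⟨dq, hdq, rfl⟩ := hdq'
  refine ⟨dq, hdq, ?_⟩
  have hsep' : Sym2.map (· + v) (sepEdge dq.fst dq.snd) ∈ (P.map φ).edges := by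
    rw [← sepEdge_add_right]; exact hsep
  rw [Walk.edges_map, List.mem_map] at hsep'
  obtain ⟨e, he, hee⟩ := hsep'
  have hinj : Function.Injective (Sym2.map (· + v : Site 2 → Site 2)) :=
    Sym2.map.injective (add_left_injective v)
  have : e = sepEdge dq.fst dq.snd := hinj (by rw [← hee]; rfl)
  exact this ▸ he

/-- **The parity lemma in a box** (`exists_faceWalk_of_bottom_top` translated to
`[L, R] × [B, T]`): if the bottom row of the box is coloured and the top row is not, there is a
walk of faces inside `[L - 1, R] × [B, T - 1]` from the column `R` to the column `L - 1` each step
of which crosses an edge of the box whose endpoints have different colours. [folklore] -/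
theorem exists_faceWalk_box (c : Site 2 → Prop) {L R B T : ℤ} (hLR : L ≤ R) (hBT : B ≤ T)
    (hbot : ∀ x : Site 2, L ≤ x 0 → x 0 ≤ R → x 1 = B → c x)
    (htop : ∀ x : Site 2, L ≤ x 0 → x 0 ≤ R → x 1 = T → ¬c x) :
    ∃ (u w : Site 2) (q : (zdGraph 2).Walk u w), u 0 = R ∧ w 0 = L - 1 ∧
      (∀ z ∈ q.support, L - 1 ≤ z 0 ∧ z 0 ≤ R ∧ B ≤ z 1 ∧ z 1 + 1 ≤ T) ∧
      ∀ d ∈ q.darts, (∀ x ∈ sepEdge d.fst d.snd, L ≤ x 0 ∧ x 0 ≤ R ∧ B ≤ x 1 ∧ x 1 ≤ T) ∧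
        (c (sepLo d.fst d.snd) ↔ ¬c (sepHi d.fst d.snd)) := by
  classical
  obtain ⟨m, hm⟩ : ∃ m : ℕ, (m : ℤ) = R - L := ⟨(R - L).toNat, Int.toNat_of_nonneg (by omega)⟩
  obtain ⟨n, hn⟩ : ∃ n : ℕ, (n : ℤ) = T - B := ⟨(T - B).toNat, Int.toNat_of_nonneg (by omega)⟩
  set v : Site 2 := ![L, B] with hv
  have hv0 : v 0 = L := rfl
  have hv1 : v 1 = B := rfl
  obtain ⟨u, w, hu, hw, q, hqs, hqd⟩ := exists_faceWalk_of_bottom_top (fun z => c (z + v)) m n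
    (fun x hx => by
      simp only [bottomSide, Finset.mem_filter, mem_rectangle_iff] at hx
      apply hbot <;> simp only [Pi.add_apply, hv0, hv1] <;> omega)
    (fun x hx => by
      simp only [topSide, Finset.mem_filter, mem_rectangle_iff] at hx
      apply htop <;> simp only [Pi.add_apply, hv0, hv1] <;> omega)
  set φ := (zdShiftIso v).toEmbedding.toHom with hφ
  have hφapply : ∀ x : Site 2, φ x = x + v := fun x => rfl
  refine ⟨φ u, φ w, q.map φ, by rw [hφapply, Pi.add_apply, hv0, hu, hm]; ring,
    by rw [hφapply, Pi.add_apply, hv0, hw]; ring, ?_, ?_⟩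
  · intro z hz
    rw [Walk.support_map, List.mem_map] at hz
    obtain ⟨z₀, hz₀, rfl⟩ := hz
    have := hqs z₀ hz₀
    simp only [hφapply, Pi.add_apply, hv0, hv1]
    omega
  · intro d hd
    rw [Walk.darts_map, List.mem_map] at hd
    obtain ⟨d₀, hd₀, rfl⟩ := hd
    obtain ⟨hlo, hhi, hc⟩ := hqd d₀ hd₀
    rw [mem_rectangle_iff] at hlo hhi
    change (∀ x ∈ sepEdge (d₀.fst + v) (d₀.snd + v), _) ∧
      (c (sepLo (d₀.fst + v) (d₀.snd + v)) ↔ ¬c (sepHi (d₀.fst + v) (d₀.snd + v)))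
    rw [sepLo_add_right, sepHi_add_right, sepEdge_add_right]
    refine ⟨fun x hx => ?_, hc⟩
    rw [Sym2.mem_map] at hx
    obtain ⟨y, hy, rfl⟩ := hx
    rw [sepEdge, Sym2.mem_iff] at hy
    simp only [Pi.add_apply, hv0, hv1]
    rcases hy with rfl | rfl <;> omega

/-! ### Straight runs of faces along a row -/

/-- A straight leftward lattice walk along a row, from `p` to a point `q` of the same row with
`q₀ ≤ p₀`; all its vertices lie on the row between `q` and `p`. [folklore] -/
theorem exists_walk_row {p q : Site 2} (h1 : p 1 = q 1) (h0 : q 0 ≤ p 0) :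
    ∃ w : (zdGraph 2).Walk p q, ∀ z ∈ w.support, z 1 = q 1 ∧ q 0 ≤ z 0 ∧ z 0 ≤ p 0 := by
  obtain ⟨k, hk⟩ : ∃ k : ℕ, p 0 = q 0 + k := ⟨(p 0 - q 0).toNat, by omega⟩
  induction k generalizing p with
  | zero =>
    obtain rfl : p = q := by rw [Site.eq_iff_two]; omega
    exact ⟨Walk.nil, fun z hz => by rw [Walk.support_nil, List.mem_singleton] at hz; subst hz; omega⟩
  | succ k ih =>
    have hadj : (zdGraph 2).Adj p (p - Pi.single 0 1) := adj_of_stepKind (.left (by simp) (by simp))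
    obtain ⟨w, hw⟩ := ih (p := p - Pi.single 0 1) (by simpa using h1) (by simp; omega)
      (by simp; omega)
    refine ⟨Walk.cons hadj w, fun z hz => ?_⟩
    rw [Walk.support_cons, List.mem_cons] at hz
    rcases hz with rfl | hz
    · omega
    · have := hw z hz
      simp only [Pi.sub_apply, single_zero_apply_zero] at this
      omega

/-- The edge separating two adjacent faces of one row is the vertical edge between them: it is
`{v, v + e₁}` with `v` on that row at the larger of the two abscissae. [folklore] -/
theorem sepEdge_eq_of_row {z z' : Site 2} (h : (zdGraph 2).Adj z z') (h1 : z 1 = z' 1) :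
    ∃ v : Site 2, sepEdge z z' = s(v, v + Pi.single 1 1) ∧ v 1 = z 1 ∧
      ((v 0 = z 0 + 1 ∧ v 0 = z' 0) ∨ (v 0 = z 0 ∧ v 0 = z' 0 + 1)) := by
  rcases stepKind_of_adj h with ⟨h0, h1'⟩ | ⟨h0, h1'⟩ | ⟨h1', h0⟩ | ⟨h1', h0⟩
  · obtain rfl : z' = z + Pi.single 0 1 := by simp [Site.eq_iff_two, h0, h1']
    exact ⟨z + Pi.single 0 1, sepEdge_right z, by simp, Or.inl ⟨by simp, rfl⟩⟩
  · obtain rfl : z = z' + Pi.single 0 1 := by simp [Site.eq_iff_two, h0, h1']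
    refine ⟨z' + Pi.single 0 1, by rw [sepEdge_comm, sepEdge_right], by simp, Or.inr ⟨rfl, by simp⟩⟩
  · omega
  · omega

end KSTPeriodic

end

end Literature.Probability.Percolation
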